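import Literature.Analysis.Fourier.ConvolutionOperatorGradient
import HarnessLib

/-!
# Fourier multiplier kernels on finite abelian groups; the pseudo-inverse of a convolution operator

On a finite abelian group `G` every translation-invariant real matrix is the kernel of a Fourier multiplier:
`A x y = |G|⁻¹ Σ_ψ σ_A(ψ) ψ(x − y)` (`apply_eq_avg_symbol_mul_addChar`, `ConvolutionOperatorGradient.lean`).  This
file sets up the converse direction — kernels DEFINED by a multiplier — and uses it to define the **pseudo-inverse**
(Green's function) of a translation-invariant operator, the multiplier `σ_A(ψ)⁻¹` (with `0⁻¹ = 0`):

* `mulKernelC m`, `mulKernel m` — the complex / real kernel `|G|⁻¹ Σ_ψ m(ψ) ψ(x − y)`; translation invariance;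
  for a **Hermitian multiplier** (`m ψ⁻¹ = conj (m ψ)`, e.g. a real even one) the complex kernel is real
  (`mulKernelC_im`, `coe_mulKernel`) and **its symbol is the multiplier** (`symbol_mulKernel`);
* a translation-invariant real matrix is the multiplier kernel of its symbol (`mulKernel_symbol`), so translation-invariant
  matrices are determined by their symbols (`eq_of_symbol_eq`); products correspond to products of multipliers
  (`mulKernel_mul`);
* `pinv A := mulKernel (σ_A)⁻¹` — translation invariant, with symbol `σ_A(ψ)⁻¹` when `A` is Hermitian
  (`symbol_pinv`); `A * pinv A = pinv A * A = mulKernel [σ_A ≠ 0]` (`mul_pinv`, `pinv_mul`); if the symbol vanishes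
  exactly at the trivial character (an operator whose kernel is the constants, such as a lattice Laplacian on a torus)
  then `A * pinv A = 1 − |G|⁻¹·𝟙` (`mul_pinv_eq_one_sub_avg`) and `A (pinv A f) = f` for mean-zero `f`
  (`mulVec_pinv_mulVec_of_sum_eq_zero`); `pinv A (A u) = u − mean` (`pinv_mulVec_mulVec`);
* kernel bounds: `abs_rowDiffs_mulKernel_le` — `|∇_{g₁}⋯∇_{g_k} (mulKernel m)(x,y)| ≤ |G|⁻¹ Σ_ψ Π‖ψ(g_i) − 1‖·‖m ψ‖`,
  in particular for `pinv` (`abs_rowDiffs_pinv_le`).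

## References
* A. Terras, Fourier Analysis on Finite Groups and Applications, LMS Student Texts 43, CUP 1999, Ch. 2, 10.
* R. Bauerschmidt, D. Brydges, G. Slade, Introduction to a renormalisation group method, LNM 2242 (2019), §1.3–1.5
  (lattice Green functions on the torus). [BauerschmidtBrydgesSlade2019]
-/

noncomputable section

open Finset
open scoped ComplexConjugate

namespace Literature.Analysis.Fourier

variable {G : Type*} [AddCommGroup G] [Fintype G]

/-! ## Multiplier kernels -/

/-- The complex kernel of the Fourier multiplier `m`: `|G|⁻¹ Σ_ψ m(ψ) ψ(x − y)`. [folklore] -/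
def mulKernelC (m : AddChar G ℂ → ℂ) : Matrix G G ℂ :=
  fun x y => (Fintype.card G : ℂ)⁻¹ * ∑ ψ : AddChar G ℂ, m ψ * ψ (x - y)

/-- The real kernel of the Fourier multiplier `m` (real part of `mulKernelC m`; equal to it for Hermitian `m`).
[folklore] -/
def mulKernel (m : AddChar G ℂ → ℂ) : Matrix G G ℝ := fun x y => (mulKernelC m x y).re

/-- Unfolding `mulKernelC`. [folklore] -/
theorem mulKernelC_apply (m : AddChar G ℂ → ℂ) (x y : G) :
    mulKernelC m x y = (Fintype.card G : ℂ)⁻¹ * ∑ ψ : AddChar G ℂ, m ψ * ψ (x - y) := rfl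

/-- Unfolding `mulKernel`. [folklore] -/
theorem mulKernel_apply (m : AddChar G ℂ → ℂ) (x y : G) : mulKernel m x y = (mulKernelC m x y).re := rfl

/-- Multiplier kernels are translation invariant. [folklore] -/
theorem isTranslationInvariant_mulKernel (m : AddChar G ℂ → ℂ) : IsTranslationInvariant (mulKernel m) := by
  intro g x y
  simp only [mulKernel_apply, mulKernelC_apply, add_sub_add_right_eq_sub]

/-- `mulKernelC` is additive in the multiplier. [folklore] -/
theorem mulKernelC_add (m m' : AddChar G ℂ → ℂ) : mulKernelC (m + m') = mulKernelC m + mulKernelC m' := by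
  funext x y
  simp only [mulKernelC_apply, Matrix.add_apply, Pi.add_apply, add_mul, Finset.sum_add_distrib, mul_add]

/-- `mulKernel` is additive in the multiplier. [folklore] -/
theorem mulKernel_add (m m' : AddChar G ℂ → ℂ) : mulKernel (m + m') = mulKernel m + mulKernel m' := by
  funext x y
  simp only [mulKernel_apply, mulKernelC_add, Matrix.add_apply, Complex.add_re]

/-- `mulKernelC` is homogeneous in the multiplier. [folklore] -/
theorem mulKernelC_smul (c : ℂ) (m : AddChar G ℂ → ℂ) : mulKernelC (c • m) = c • mulKernelC m := by
  funext x y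
  simp only [mulKernelC_apply, Matrix.smul_apply, Pi.smul_apply, smul_eq_mul, mul_assoc, ← Finset.mul_sum]
  ring

/-- `mulKernelC` of a difference. [folklore] -/
theorem mulKernelC_sub (m m' : AddChar G ℂ → ℂ) : mulKernelC (m - m') = mulKernelC m - mulKernelC m' := by
  funext x y
  simp only [mulKernelC_apply, Matrix.sub_apply, Pi.sub_apply, sub_mul, Finset.sum_sub_distrib, mul_sub]

/-- `mulKernel` of a difference. [folklore] -/
theorem mulKernel_sub (m m' : AddChar G ℂ → ℂ) : mulKernel (m - m') = mulKernel m - mulKernel m' := by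
  funext x y
  simp only [mulKernel_apply, mulKernelC_sub, Matrix.sub_apply, Complex.sub_re]

/-- The kernel of the constant multiplier `1` is the identity matrix (orthogonality of characters). [folklore] -/
theorem mulKernelC_one [DecidableEq G] : mulKernelC (fun _ : AddChar G ℂ => (1 : ℂ)) = 1 := by
  funext x y
  rw [mulKernelC_apply]
  simp only [one_mul, AddChar.sum_apply_eq_ite, sub_eq_zero]
  by_cases h : x = y
  · subst h
    simp [Nat.cast_ne_zero.2 Fintype.card_ne_zero]
  · simp [h]

/-- The kernel of the indicator of the trivial character is the averaging matrix `|G|⁻¹`. [folklore] -/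
theorem mulKernelC_indicator_one [DecidableEq G] (x y : G) :
    mulKernelC (fun ψ : AddChar G ℂ => if ψ = 1 then (1 : ℂ) else 0) x y = (Fintype.card G : ℂ)⁻¹ := by
  rw [mulKernelC_apply, Finset.sum_eq_single (1 : AddChar G ℂ)]
  · simp
  · intro ψ _ hψ; simp [hψ]
  · intro h; exact absurd (Finset.mem_univ _) h

/-! ## Hermitian multipliers: realness and the symbol -/

/-- A multiplier is **Hermitian** if `m ψ⁻¹ = conj (m ψ)` (then its kernel is real); real even multipliers —
symbols of real symmetric matrices and functions of them — are Hermitian. [folklore] -/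
def IsHermitianMultiplier (m : AddChar G ℂ → ℂ) : Prop := ∀ ψ : AddChar G ℂ, m ψ⁻¹ = conj (m ψ)

/-- The complex kernel of a Hermitian multiplier is real. [folklore] -/
theorem conj_mulKernelC {m : AddChar G ℂ → ℂ} (hm : IsHermitianMultiplier m) (x y : G) :
    conj (mulKernelC m x y) = mulKernelC m x y := by
  rw [mulKernelC_apply, map_mul, map_inv₀, Complex.conj_natCast, map_sum]
  congr 1
  rw [← Equiv.sum_comp (Equiv.inv (AddChar G ℂ))]
  refine Finset.sum_congr rfl fun ψ _ => ?_
  simp only [Equiv.inv_apply, map_mul, hm ψ, AddChar.inv_apply, AddChar.map_neg_eq_conj, Complex.conj_conj]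

/-- The complex kernel of a Hermitian multiplier has zero imaginary part. [folklore] -/
theorem mulKernelC_im {m : AddChar G ℂ → ℂ} (hm : IsHermitianMultiplier m) (x y : G) : (mulKernelC m x y).im = 0 :=
  Complex.conj_eq_iff_im.1 (conj_mulKernelC hm x y)

/-- For a Hermitian multiplier the real kernel, cast back to `ℂ`, is the complex kernel. [folklore] -/
theorem coe_mulKernel {m : AddChar G ℂ → ℂ} (hm : IsHermitianMultiplier m) (x y : G) :
    (mulKernel m x y : ℂ) = mulKernelC m x y := by
  rw [mulKernel_apply]
  exact Complex.ext (by simp) (by simp [mulKernelC_im hm x y])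

/-- Orthogonality of characters in the form `Σ_y ψ(y) χ(−y) = |G|·[ψ = χ]`. [folklore] -/
theorem sum_mul_apply_neg_eq_ite [DecidableEq G] (ψ χ : AddChar G ℂ) :
    ∑ y : G, ψ y * χ (-y) = if ψ = χ then (Fintype.card G : ℂ) else 0 := by
  classical
  have h : ∑ y : G, ψ y * χ (-y) = ∑ y : G, (ψ - χ) y := Finset.sum_congr rfl fun y _ => (AddChar.sub_apply ψ χ y).symm
  rw [h, AddChar.sum_eq_ite]
  by_cases hψ : ψ = χ
  · subst hψ; simp
  · rw [if_neg (sub_ne_zero.2 hψ), if_neg hψ]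

/-- **The symbol of a multiplier kernel is the multiplier** (Hermitian `m`). [folklore] -/
theorem symbol_mulKernel [DecidableEq G] {m : AddChar G ℂ → ℂ} (hm : IsHermitianMultiplier m) (ψ : AddChar G ℂ) :
    symbol (mulKernel m) ψ = m ψ := by
  unfold symbol
  simp only [coe_mulKernel hm, mulKernelC_apply, zero_sub]
  have hc : (Fintype.card G : ℂ) ≠ 0 := Nat.cast_ne_zero.2 Fintype.card_ne_zero
  calc ∑ y : G, (Fintype.card G : ℂ)⁻¹ * (∑ χ : AddChar G ℂ, m χ * χ (-y)) * ψ y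
      = (Fintype.card G : ℂ)⁻¹ * ∑ χ : AddChar G ℂ, m χ * ∑ y : G, ψ y * χ (-y) := by
        simp only [Finset.sum_mul, Finset.mul_sum]
        rw [Finset.sum_comm]
        exact Finset.sum_congr rfl fun χ _ => Finset.sum_congr rfl fun y _ => by ring
    _ = (Fintype.card G : ℂ)⁻¹ * (m ψ * Fintype.card G) := by
        congr 1
        simp only [sum_mul_apply_neg_eq_ite]
        rw [Finset.sum_eq_single ψ]
        · simp
        · intro χ _ hχ
          rw [if_neg (Ne.symm hχ), mul_zero]
        · intro h; exact absurd (Finset.mem_univ _) h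
    _ = m ψ := by field_simp

/-- The symbol of a real matrix is an even-Hermitian function of the character: `σ_A(ψ⁻¹) = conj σ_A(ψ)`. [folklore] -/
theorem isHermitianMultiplier_symbol (A : Matrix G G ℝ) : IsHermitianMultiplier (symbol A) := by
  intro ψ
  unfold symbol
  rw [map_sum]
  refine Finset.sum_congr rfl fun y _ => ?_
  rw [map_mul, Complex.conj_ofReal, AddChar.inv_apply, AddChar.map_neg_eq_conj]

omit [Fintype G] in
/-- Hermitian multipliers are closed under pointwise products. [folklore] -/
theorem IsHermitianMultiplier.mul {m m' : AddChar G ℂ → ℂ} (hm : IsHermitianMultiplier m)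
    (hm' : IsHermitianMultiplier m') : IsHermitianMultiplier (m * m') := fun ψ => by
  simp only [Pi.mul_apply, hm ψ, hm' ψ, map_mul]

omit [Fintype G] in
/-- Hermitian multipliers are closed under pointwise inversion. [folklore] -/
theorem IsHermitianMultiplier.inv {m : AddChar G ℂ → ℂ} (hm : IsHermitianMultiplier m) :
    IsHermitianMultiplier (fun ψ => (m ψ)⁻¹) := fun ψ => by
  simp only [hm ψ, map_inv₀]

omit [Fintype G] in
/-- Indicators of self-inverse-closed sets of characters defined through the symbol are Hermitian: `[m ψ = 0]`.
[folklore] -/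
theorem IsHermitianMultiplier.indicator_eq_zero {m : AddChar G ℂ → ℂ} (hm : IsHermitianMultiplier m) :
    IsHermitianMultiplier (fun ψ => if m ψ = 0 then (1 : ℂ) else 0) := fun ψ => by
  simp only [hm ψ, map_eq_zero]
  split_ifs <;> simp

omit [Fintype G] in
/-- Indicator of the non-vanishing set of a Hermitian multiplier is Hermitian: `[m ψ ≠ 0]`. [folklore] -/
theorem IsHermitianMultiplier.indicator_ne_zero {m : AddChar G ℂ → ℂ} (hm : IsHermitianMultiplier m) :
    IsHermitianMultiplier (fun ψ => if m ψ = 0 then (0 : ℂ) else 1) := fun ψ => by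
  simp only [hm ψ, map_eq_zero]
  split_ifs <;> simp

/-- **A translation-invariant real matrix is the multiplier kernel of its symbol.** [folklore] -/
theorem mulKernel_symbol [DecidableEq G] {A : Matrix G G ℝ} (hA : IsTranslationInvariant A) : mulKernel (symbol A) = A := by
  funext x y
  have h := apply_eq_avg_symbol_mul_addChar hA x y
  rw [mulKernel_apply, mulKernelC_apply, ← h, Complex.ofReal_re]

/-- **Translation-invariant matrices are determined by their symbols.** [folklore] -/
theorem eq_of_symbol_eq [DecidableEq G] {A B : Matrix G G ℝ} (hA : IsTranslationInvariant A)
    (hB : IsTranslationInvariant B) (h : ∀ ψ : AddChar G ℂ, symbol A ψ = symbol B ψ) : A = B := by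
  rw [← mulKernel_symbol hA, ← mulKernel_symbol hB]
  congr 1
  exact funext h

/-- **Products of multiplier kernels**: `mulKernel m * mulKernel m' = mulKernel (m·m')` for Hermitian multipliers.
[folklore] -/
theorem mulKernel_mul [DecidableEq G] {m m' : AddChar G ℂ → ℂ} (hm : IsHermitianMultiplier m)
    (hm' : IsHermitianMultiplier m') : mulKernel m * mulKernel m' = mulKernel (m * m') := by
  refine eq_of_symbol_eq ((isTranslationInvariant_mulKernel m).mul (isTranslationInvariant_mulKernel m'))
    (isTranslationInvariant_mulKernel _) fun ψ => ?_
  rw [symbol_mul ψ (mulKernel m) (isTranslationInvariant_mulKernel m'), symbol_mulKernel hm, symbol_mulKernel hm',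
    symbol_mulKernel (hm.mul hm'), Pi.mul_apply]

/-- The kernel of the constant multiplier `1` is the identity. [folklore] -/
theorem mulKernel_one [DecidableEq G] : mulKernel (fun _ : AddChar G ℂ => (1 : ℂ)) = (1 : Matrix G G ℝ) := by
  funext x y
  rw [mulKernel_apply, mulKernelC_one]
  by_cases h : x = y
  · subst h; simp
  · simp [h]

/-- The kernel of the indicator of the trivial character is the constant matrix `|G|⁻¹` (averaging). [folklore] -/
theorem mulKernel_indicator_one [DecidableEq G] (x y : G) :
    mulKernel (fun ψ : AddChar G ℂ => if ψ = 1 then (1 : ℂ) else 0) x y = (Fintype.card G : ℝ)⁻¹ := by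
  rw [mulKernel_apply, mulKernelC_indicator_one]
  simp

/-! ## The pseudo-inverse of a translation-invariant operator -/

/-- **The pseudo-inverse (Green's function)** of a translation-invariant real matrix: the kernel of the multiplier
`σ_A(ψ)⁻¹` (with the convention `0⁻¹ = 0`, so the modes in the kernel of `A` are sent to `0`). [folklore] -/
def pinv (A : Matrix G G ℝ) : Matrix G G ℝ := mulKernel fun ψ => (symbol A ψ)⁻¹

/-- `pinv A` is translation invariant. [folklore] -/
theorem isTranslationInvariant_pinv (A : Matrix G G ℝ) : IsTranslationInvariant (pinv A) :=
  isTranslationInvariant_mulKernel _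

/-- **The symbol of the pseudo-inverse** is `σ_A(ψ)⁻¹`. [folklore] -/
theorem symbol_pinv [DecidableEq G] (A : Matrix G G ℝ) (ψ : AddChar G ℂ) : symbol (pinv A) ψ = (symbol A ψ)⁻¹ :=
  symbol_mulKernel (isHermitianMultiplier_symbol A).inv ψ

/-- `A * pinv A` is the multiplier kernel of the indicator of `{σ_A ≠ 0}` (the orthogonal projection onto the range).
[folklore] -/
theorem mul_pinv [DecidableEq G] {A : Matrix G G ℝ} (hA : IsTranslationInvariant A) :
    A * pinv A = mulKernel (fun ψ => if symbol A ψ = 0 then (0 : ℂ) else 1) := by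
  rw [pinv]
  nth_rewrite 1 [← mulKernel_symbol hA]
  rw [mulKernel_mul (isHermitianMultiplier_symbol A) (isHermitianMultiplier_symbol A).inv]
  congr 1
  funext ψ
  simp only [Pi.mul_apply]
  split_ifs with h
  · rw [h, zero_mul]
  · rw [mul_inv_cancel₀ h]

/-- `pinv A * A = A * pinv A`. [folklore] -/
theorem pinv_mul [DecidableEq G] {A : Matrix G G ℝ} (hA : IsTranslationInvariant A) :
    pinv A * A = mulKernel (fun ψ => if symbol A ψ = 0 then (0 : ℂ) else 1) := by
  rw [pinv]
  nth_rewrite 2 [← mulKernel_symbol hA]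
  rw [mulKernel_mul (isHermitianMultiplier_symbol A).inv (isHermitianMultiplier_symbol A)]
  congr 1
  funext ψ
  simp only [Pi.mul_apply]
  split_ifs with h
  · rw [h, mul_zero]
  · rw [inv_mul_cancel₀ h]

/-- `pinv` commutes with `A`. [folklore] -/
theorem pinv_mul_eq_mul_pinv [DecidableEq G] {A : Matrix G G ℝ} (hA : IsTranslationInvariant A) :
    pinv A * A = A * pinv A := by
  rw [pinv_mul hA, mul_pinv hA]

/-- **If the symbol vanishes exactly at the trivial character** (kernel of `A` = constants) then
`A * pinv A = 1 − |G|⁻¹·𝟙`, the projection onto mean-zero vectors. [folklore] -/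
theorem mul_pinv_eq_one_sub_avg [DecidableEq G] {A : Matrix G G ℝ} (hA : IsTranslationInvariant A)
    (h0 : ∀ ψ : AddChar G ℂ, symbol A ψ = 0 ↔ ψ = 1) :
    A * pinv A = 1 - Matrix.of fun _ _ : G => (Fintype.card G : ℝ)⁻¹ := by
  rw [mul_pinv hA]
  have hm : (fun ψ : AddChar G ℂ => if symbol A ψ = 0 then (0 : ℂ) else 1)
      = (fun _ => (1 : ℂ)) - fun ψ => if ψ = 1 then (1 : ℂ) else 0 := by
    funext ψ
    simp only [Pi.sub_apply, h0 ψ]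
    split_ifs <;> norm_num
  rw [hm, mulKernel_sub, mulKernel_one]
  congr 1
  funext x y
  rw [Matrix.of_apply, mulKernel_indicator_one]

/-- **`A (pinv A f) = f` for mean-zero `f`** when the kernel of `A` is the constants. [folklore] -/
theorem mulVec_pinv_mulVec_of_sum_eq_zero [DecidableEq G] {A : Matrix G G ℝ} (hA : IsTranslationInvariant A)
    (h0 : ∀ ψ : AddChar G ℂ, symbol A ψ = 0 ↔ ψ = 1) {f : G → ℝ} (hf : ∑ x, f x = 0) :
    A.mulVec ((pinv A).mulVec f) = f := by
  rw [Matrix.mulVec_mulVec, mul_pinv_eq_one_sub_avg hA h0, Matrix.sub_mulVec, Matrix.one_mulVec]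
  have : (Matrix.of fun _ _ : G => (Fintype.card G : ℝ)⁻¹).mulVec f = 0 := by
    funext x
    simp only [Matrix.mulVec, dotProduct, Matrix.of_apply, ← Finset.mul_sum, hf, mul_zero, Pi.zero_apply]
  rw [this, sub_zero]

/-- **`pinv A (A u) = u − mean u`** when the kernel of `A` is the constants. [folklore] -/
theorem pinv_mulVec_mulVec [DecidableEq G] {A : Matrix G G ℝ} (hA : IsTranslationInvariant A)
    (h0 : ∀ ψ : AddChar G ℂ, symbol A ψ = 0 ↔ ψ = 1) (u : G → ℝ) :
    (pinv A).mulVec (A.mulVec u) = fun x => u x - (Fintype.card G : ℝ)⁻¹ * ∑ y, u y := by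
  rw [Matrix.mulVec_mulVec, pinv_mul_eq_mul_pinv hA, mul_pinv_eq_one_sub_avg hA h0, Matrix.sub_mulVec,
    Matrix.one_mulVec]
  funext x
  simp only [Pi.sub_apply, Matrix.mulVec, dotProduct, Matrix.of_apply, ← Finset.mul_sum]

/-- The range indicator times `pinv`: `pinv A * A * pinv A = pinv A`. [folklore] -/
theorem pinv_mul_mul_pinv [DecidableEq G] {A : Matrix G G ℝ} (hA : IsTranslationInvariant A) :
    pinv A * A * pinv A = pinv A := by
  rw [pinv_mul hA, pinv, mulKernel_mul (isHermitianMultiplier_symbol A).indicator_ne_zero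
    (isHermitianMultiplier_symbol A).inv]
  congr 1
  funext ψ
  simp only [Pi.mul_apply]
  split_ifs with h
  · rw [h, inv_zero, mul_zero]
  · rw [one_mul]

/-! ## Kernel bounds for multiplier kernels -/

/-- **Gradient kernel bound for multiplier kernels**: each forward difference along `g` costs a factor `‖ψ(g) − 1‖`:
`|∇_{g₁}⋯∇_{g_k}(mulKernel m)(x,y)| ≤ |G|⁻¹ Σ_ψ (Π_i ‖ψ(g_i) − 1‖)·‖m ψ‖` (Hermitian `m`). [folklore] -/
theorem abs_rowDiffs_mulKernel_le [DecidableEq G] {m : AddChar G ℂ → ℂ} (hm : IsHermitianMultiplier m)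
    (l : List G) (x y : G) :
    |rowDiffs l (mulKernel m) x y|
      ≤ (Fintype.card G : ℝ)⁻¹ * ∑ ψ : AddChar G ℂ, (l.map fun g => ‖ψ g - 1‖).prod * ‖m ψ‖ := by
  have h := abs_rowDiffs_apply_le (isTranslationInvariant_mulKernel m) l x y
  simpa only [symbol_mulKernel hm] using h

/-- **Gradient kernel bound for the pseudo-inverse**:
`|∇_{g₁}⋯∇_{g_k}(pinv A)(x,y)| ≤ |G|⁻¹ Σ_ψ (Π_i ‖ψ(g_i) − 1‖)·‖σ_A(ψ)‖⁻¹`. [folklore] -/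
theorem abs_rowDiffs_pinv_le [DecidableEq G] (A : Matrix G G ℝ) (l : List G) (x y : G) :
    |rowDiffs l (pinv A) x y|
      ≤ (Fintype.card G : ℝ)⁻¹ * ∑ ψ : AddChar G ℂ, (l.map fun g => ‖ψ g - 1‖).prod * ‖symbol A ψ‖⁻¹ := by
  have h := abs_rowDiffs_mulKernel_le (isHermitianMultiplier_symbol A).inv l x y
  unfold pinv
  simpa only [norm_inv] using h

/-- The pseudo-inverse of a Hermitian positive semidefinite translation-invariant matrix has nonnegative real symbol.
[folklore] -/
theorem symbol_pinv_re_nonneg [DecidableEq G] {A : Matrix G G ℝ} (hA : IsTranslationInvariant A) (hP : A.PosSemidef)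
    (ψ : AddChar G ℂ) : 0 ≤ (symbol (pinv A) ψ).re := by
  rw [symbol_pinv]
  have him : (symbol A ψ).im = 0 := symbol_im ψ hA hP.1
  have hre : 0 ≤ (symbol A ψ).re := symbol_re_nonneg ψ hA hP
  have h : symbol A ψ = ((symbol A ψ).re : ℂ) := Complex.ext (by simp) (by simp [him])
  rw [h, ← Complex.ofReal_inv, Complex.ofReal_re]
  exact inv_nonneg.2 hre

/-- The pseudo-inverse has real symbol. [folklore] -/
theorem symbol_pinv_im [DecidableEq G] {A : Matrix G G ℝ} (hA : IsTranslationInvariant A) (hs : A.IsHermitian)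
    (ψ : AddChar G ℂ) : (symbol (pinv A) ψ).im = 0 := by
  rw [symbol_pinv]
  have him : (symbol A ψ).im = 0 := symbol_im ψ hA hs
  have h : symbol A ψ = ((symbol A ψ).re : ℂ) := Complex.ext (by simp) (by simp [him])
  rw [h, ← Complex.ofReal_inv, Complex.ofReal_im]

end Literature.Analysis.Fourier

end
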